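import Literature.Analysis.FluidPDE.KNSSSwirlSupNonpos
import Mathlib.Analysis.SpecialFunctions.Trigonometric.ArctanDeriv
import HarnessLib

/-!
# Lei–Ren–Zhang 2019, Theorem 1.2: the one-dimensional integrals of the energy estimate

Analysis/FluidPDE proof file (no definitions, no named facts, no `sorry`) on the discharge path of
the named fact `Literature.Analysis.FluidPDE.leiRenZhang2019_liouville_swirl_rate` (Z. Lei,
X. Ren, Q. S. Zhang, arXiv:1902.11229, Theorem 1.2, proof in §4, pp. 10–12).

Every term of the weighted energy identity (`LeiRenZhangSwirlEnergyIdentity`) other than the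
dissipation and the axis source is bounded in the printed proof (§4, Steps 3–5) by integrating a
pointwise bound of product form `φ(t) h(r) g(z)` against `λ(r) dr dz dt`. This file provides that
reduction and the elementary radial integrals it produces:

* `abs_integral_slab_le_of_bound`, `abs_integral_le_of_bound_cyl`: if `|Φ(s, x)| ≤ φ(s) h(r(x)) g(x₂)`
  (resp. `|F(x)| ≤ h(r(x)) g(x₂)`) then `|∫∫ Φ| ≤ (∫ φ)(∫ g)(c₂ ∫₀^∞ ρ h(ρ) dρ)`
  (resp. `|∫ F dx| ≤ (∫ g)(c₂ ∫₀^∞ ρ h)`), `c₂ = 2π` (`radialConst₂`; Fubini and the radial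
  reduction `integrable_and_integral_fun_cylRadius_mul` of `CylindricalIntegration`);
* the integrals `∫₀^∞ dρ/(r₀² + ρ²) = π/(2r₀)`, `∫_c^∞ ρ dρ/(r₀² + ρ²)² = 1/(2(r₀² + c²))`,
  `∫₀^∞ dρ/(r₀² + ρ²)² ≤ π/(2r₀³)`;
* the **envelope** `e(ρ) = K₁` for `ρ ≤ r₁`, `= E/ρ` for `ρ > r₁` of `|Γ² − L²|` under the rate
  hypothesis (4.1) of Theorem 1.2 (`|Γ² − L²| ≤ ε₀ L²/r` for large `r`; `E = ε₀L²`, `K₁` a global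
  bound) and the bounds `∫₀^∞ ρ e(ρ) φ(ρ) dρ ≤ K₁ r₁ A + E ∫₀^∞ φ` (`ρφ ≤ A` on `(0, r₁]`),
  `∫₀^∞ e ψ ≤ K₁ r₁ A' + (E/r₁) ∫₀^∞ ψ` (`ψ ≤ A'` on `(0, r₁]`): the printed
  "`|I₁| ≤ C R T sup |v_r| r₀ ∫ ε/r² dr ≤ C ε R T`" (Step 5, p. 11) and its companions;
* `radial_junk_integral_le`: the resulting bound for the radial integral of the envelope against
  the pointwise bound of the junk terms of `LeiRenZhangSwirlWeights` (`abs_junk_productWeight_le`).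

## References

* Z. Lei, X. Ren, Q. S. Zhang, arXiv:1902.11229, §4, Steps 3–5, (4.5)–(4.13) (pp. 10–12).
  [LeiRenZhang2019]
-/

noncomputable section

open MeasureTheory Set Function Filter Topology TopologicalSpace InnerProductSpace WithLp Metric Real
open scoped RealInnerProductSpace

namespace Literature.Analysis.FluidPDE

/-! ### Reduction of space–time integrals with product bounds to radial integrals -/

section Reduction

/-- **Space–time integrals with a product bound.** On `μ = dt|_{(a,b']} ⊗ dx`, if `Φ` is integrable
and `|Φ(s, x)| ≤ φ(s) h(r(x)) g(x₂)` a.e., with `ρ ↦ ρ h(ρ)` integrable on `(0, ∞)`, `g` integrable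
and `φ` integrable on `(a, b']`, then `|∫ Φ dμ| ≤ (∫_{(a,b']} φ) (∫ g) (c₂ ∫₀^∞ ρ h(ρ) dρ)`
(Fubini and `dx = r dr dθ dz`; Lei–Ren–Zhang 2019, §4, Steps 3–5: every bound of the form
`C R T · (radial integral)`). [cite: LeiRenZhang2019, §4 Steps 3–5 (arXiv pp. 10–12)] -/
theorem abs_integral_slab_le_of_bound {Φ : ℝ × EuclideanSpace ℝ (Fin 3) → ℝ} {φ h g : ℝ → ℝ} {a b' : ℝ}
    (hΦ : Integrable Φ ((volume.restrict (Ioc a b')).prod (volume : Measure (EuclideanSpace ℝ (Fin 3)))))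
    (hh : IntegrableOn (fun ρ => ρ * h ρ) (Ioi 0)) (hg : Integrable g) (hφ : IntegrableOn φ (Ioc a b'))
    (hbound : ∀ᵐ p ∂((volume.restrict (Ioc a b')).prod (volume : Measure (EuclideanSpace ℝ (Fin 3)))),
      |Φ p| ≤ φ p.1 * (h (cylRadius p.2) * g (p.2 2))) :
    |∫ p, Φ p ∂((volume.restrict (Ioc a b')).prod (volume : Measure (EuclideanSpace ℝ (Fin 3))))| ≤
      (∫ s in Ioc a b', φ s) * ((∫ z, g z) * (radialConst₂ * ∫ ρ in Ioi (0 : ℝ), ρ * h ρ)) := by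
  obtain ⟨hHi, hH⟩ := integrable_and_integral_fun_cylRadius_mul hh hg
  have hprod : Integrable (fun p : ℝ × EuclideanSpace ℝ (Fin 3) => φ p.1 * (h (cylRadius p.2) * g (p.2 2)))
      ((volume.restrict (Ioc a b')).prod (volume : Measure (EuclideanSpace ℝ (Fin 3)))) :=
    hφ.mul_prod hHi
  calc |∫ p, Φ p ∂((volume.restrict (Ioc a b')).prod (volume : Measure (EuclideanSpace ℝ (Fin 3))))|
      ≤ ∫ p, |Φ p| ∂((volume.restrict (Ioc a b')).prod (volume : Measure (EuclideanSpace ℝ (Fin 3)))) := by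
        rw [← Real.norm_eq_abs]
        exact (norm_integral_le_integral_norm _).trans_eq (integral_congr_ae (Eventually.of_forall fun p => Real.norm_eq_abs _))
    _ ≤ ∫ p, φ p.1 * (h (cylRadius p.2) * g (p.2 2))
          ∂((volume.restrict (Ioc a b')).prod (volume : Measure (EuclideanSpace ℝ (Fin 3)))) :=
        integral_mono_ae hΦ.abs hprod hbound
    _ = (∫ s in Ioc a b', φ s) * ∫ x : EuclideanSpace ℝ (Fin 3), h (cylRadius x) * g (x 2) :=
        integral_prod_mul (μ := volume.restrict (Ioc a b')) (ν := (volume : Measure (EuclideanSpace ℝ (Fin 3))))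
          φ (fun x : EuclideanSpace ℝ (Fin 3) => h (cylRadius x) * g (x 2))
    _ = (∫ s in Ioc a b', φ s) * ((∫ z, g z) * (radialConst₂ * ∫ ρ in Ioi (0 : ℝ), ρ * h ρ)) := by rw [hH]

/-- **Space integrals with a product bound**: if `|F(x)| ≤ h(r(x)) g(x₂)` a.e. with `ρ h(ρ)`
integrable on `(0, ∞)` and `g` integrable, then `|∫ F dx| ≤ (∫ g)(c₂ ∫₀^∞ ρ h(ρ) dρ)`. [folklore] -/
theorem abs_integral_le_of_bound_cyl {F : EuclideanSpace ℝ (Fin 3) → ℝ} {h g : ℝ → ℝ}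
    (hF : Integrable F) (hh : IntegrableOn (fun ρ => ρ * h ρ) (Ioi 0)) (hg : Integrable g)
    (hbound : ∀ᵐ x ∂(volume : Measure (EuclideanSpace ℝ (Fin 3))), |F x| ≤ h (cylRadius x) * g (x 2)) :
    |∫ x, F x| ≤ (∫ z, g z) * (radialConst₂ * ∫ ρ in Ioi (0 : ℝ), ρ * h ρ) := by
  obtain ⟨hHi, hH⟩ := integrable_and_integral_fun_cylRadius_mul hh hg
  calc |∫ x, F x| ≤ ∫ x, |F x| := by
        rw [← Real.norm_eq_abs]
        exact (norm_integral_le_integral_norm _).trans_eq (integral_congr_ae (Eventually.of_forall fun p => Real.norm_eq_abs _))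
    _ ≤ ∫ x : EuclideanSpace ℝ (Fin 3), h (cylRadius x) * g (x 2) := integral_mono_ae hF.abs hHi hbound
    _ = (∫ z, g z) * (radialConst₂ * ∫ ρ in Ioi (0 : ℝ), ρ * h ρ) := hH

/-- The integral of the indicator of `[-c, c]`: `∫ 1_{|z| ≤ c} dz = 2c` for `c ≥ 0`, and it is
integrable. [folklore] -/
theorem integrable_and_integral_indicator_abs_le {c : ℝ} (hc : 0 ≤ c) :
    Integrable (fun z : ℝ => (Icc (-c) c).indicator (fun _ => (1 : ℝ)) z) ∧
    ∫ z : ℝ, (Icc (-c) c).indicator (fun _ => (1 : ℝ)) z = 2 * c := by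
  refine ⟨(integrableOn_const (C := (1 : ℝ)) (by exact measure_Icc_lt_top.ne)).integrable_indicator
    measurableSet_Icc, ?_⟩
  rw [integral_indicator measurableSet_Icc, setIntegral_const, Real.volume_real_Icc_of_le (by linarith),
    smul_eq_mul, mul_one]
  ring

end Reduction

/-! ### Elementary radial integrals -/

section Elementary

/-- `∫₀^∞ dρ / (r₀² + ρ²) = π / (2 r₀)` for `r₀ > 0`, with integrability (antiderivative
`arctan(ρ/r₀)/r₀`). [folklore] -/
theorem integrableOn_and_integral_Ioi_inv_sq_add_sq {r₀ : ℝ} (hr₀ : 0 < r₀) :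
    IntegrableOn (fun ρ : ℝ => (r₀ ^ 2 + ρ ^ 2)⁻¹) (Ioi 0) ∧
    ∫ ρ in Ioi (0 : ℝ), (r₀ ^ 2 + ρ ^ 2)⁻¹ = π / (2 * r₀) := by
  set g : ℝ → ℝ := fun ρ => arctan (ρ / r₀) / r₀ with hg
  have hderiv : ∀ ρ ∈ Ici (0 : ℝ), HasDerivAt g ((r₀ ^ 2 + ρ ^ 2)⁻¹) ρ := by
    intro ρ _
    have h1 : HasDerivAt (fun ρ : ℝ => ρ / r₀) (1 / r₀) ρ := (hasDerivAt_id ρ).div_const r₀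
    have h2 := ((hasDerivAt_arctan' (ρ / r₀)).comp ρ h1).div_const r₀
    refine h2.congr_deriv ?_
    have hr : r₀ ≠ 0 := hr₀.ne'
    field_simp
  have hpos : ∀ ρ ∈ Ioi (0 : ℝ), 0 ≤ (r₀ ^ 2 + ρ ^ 2)⁻¹ := fun ρ _ => by positivity
  have hlim : Tendsto g atTop (𝓝 (π / 2 / r₀)) := by
    have h1 : Tendsto (fun ρ : ℝ => ρ / r₀) atTop atTop := tendsto_id.atTop_div_const hr₀
    have h2 : Tendsto arctan atTop (𝓝 (π / 2)) := tendsto_arctan_atTop.mono_right nhdsWithin_le_nhds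
    exact (h2.comp h1).div_const r₀
  refine ⟨integrableOn_Ioi_deriv_of_nonneg' hderiv hpos hlim, ?_⟩
  rw [integral_Ioi_of_hasDerivAt_of_nonneg' hderiv hpos hlim]
  simp only [hg, zero_div, arctan_zero, sub_zero]
  field_simp

/-- `∫_c^∞ ρ dρ / (r₀² + ρ²)² = 1 / (2 (r₀² + c²))` for `r₀ > 0`, `c ≥ 0`, with integrability
(antiderivative `−1/(2(r₀² + ρ²))`). [folklore] -/
theorem integrableOn_and_integral_Ioi_mul_inv_sq_add_sq_sq {r₀ c : ℝ} (hr₀ : 0 < r₀) (hc : 0 ≤ c) :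
    IntegrableOn (fun ρ : ℝ => ρ / (r₀ ^ 2 + ρ ^ 2) ^ 2) (Ioi c) ∧
    ∫ ρ in Ioi c, ρ / (r₀ ^ 2 + ρ ^ 2) ^ 2 = 1 / (2 * (r₀ ^ 2 + c ^ 2)) := by
  set g : ℝ → ℝ := fun ρ => -(1 / (2 * (r₀ ^ 2 + ρ ^ 2))) with hg
  have hderiv : ∀ ρ ∈ Ici c, HasDerivAt g (ρ / (r₀ ^ 2 + ρ ^ 2) ^ 2) ρ := by
    intro ρ _
    have hD : HasDerivAt (fun ρ : ℝ => 2 * (r₀ ^ 2 + ρ ^ 2)) (2 * (2 * ρ)) ρ := by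
      have := ((hasDerivAt_id ρ).fun_pow 2).const_add (r₀ ^ 2)
      have := this.const_mul 2
      refine this.congr_deriv ?_
      simp
    have hne : 2 * (r₀ ^ 2 + ρ ^ 2) ≠ 0 := by positivity
    have h := ((hasDerivAt_const ρ (1 : ℝ)).div hD hne).neg
    refine h.congr_deriv ?_
    have hne' : r₀ ^ 2 + ρ ^ 2 ≠ 0 := by positivity
    field_simp
    ring
  have hpos : ∀ ρ ∈ Ioi c, 0 ≤ ρ / (r₀ ^ 2 + ρ ^ 2) ^ 2 := fun ρ hρ => by
    have : 0 ≤ ρ := hc.trans (le_of_lt hρ)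
    positivity
  have hlim : Tendsto g atTop (𝓝 0) := by
    have h1 : Tendsto (fun ρ : ℝ => 2 * (r₀ ^ 2 + ρ ^ 2)) atTop atTop := by
      refine Tendsto.const_mul_atTop (by norm_num) ?_
      exact tendsto_atTop_add_const_left _ _ (tendsto_pow_atTop two_ne_zero)
    have h2 := h1.inv_tendsto_atTop
    have h3 : Tendsto (fun ρ : ℝ => -(2 * (r₀ ^ 2 + ρ ^ 2))⁻¹) atTop (𝓝 0) := by simpa using h2.neg
    refine h3.congr fun ρ => ?_
    simp only [hg, one_div]
  refine ⟨integrableOn_Ioi_deriv_of_nonneg' hderiv hpos hlim, ?_⟩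
  rw [integral_Ioi_of_hasDerivAt_of_nonneg' hderiv hpos hlim]
  simp only [hg]
  ring

/-- `∫₀^∞ dρ / (r₀² + ρ²)² ≤ π / (2 r₀³)` for `r₀ > 0`, with integrability
(`(r₀² + ρ²)⁻² ≤ r₀⁻² (r₀² + ρ²)⁻¹`). [folklore] -/
theorem integrableOn_and_integral_Ioi_inv_sq_add_sq_sq_le {r₀ : ℝ} (hr₀ : 0 < r₀) :
    IntegrableOn (fun ρ : ℝ => ((r₀ ^ 2 + ρ ^ 2) ^ 2)⁻¹) (Ioi 0) ∧
    ∫ ρ in Ioi (0 : ℝ), ((r₀ ^ 2 + ρ ^ 2) ^ 2)⁻¹ ≤ π / (2 * r₀ ^ 3) := by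
  obtain ⟨hi, hval⟩ := integrableOn_and_integral_Ioi_inv_sq_add_sq hr₀
  have hdom : IntegrableOn (fun ρ : ℝ => (r₀ ^ 2)⁻¹ * (r₀ ^ 2 + ρ ^ 2)⁻¹) (Ioi 0) := hi.const_mul _
  have hptw : ∀ ρ : ℝ, ((r₀ ^ 2 + ρ ^ 2) ^ 2)⁻¹ ≤ (r₀ ^ 2)⁻¹ * (r₀ ^ 2 + ρ ^ 2)⁻¹ := fun ρ => by
    rw [← mul_inv, sq]
    refine inv_anti₀ (by positivity) (mul_le_mul_of_nonneg_right ?_ (by positivity))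
    nlinarith [sq_nonneg ρ]
  have hmeas : AEStronglyMeasurable (fun ρ : ℝ => ((r₀ ^ 2 + ρ ^ 2) ^ 2)⁻¹) (volume.restrict (Ioi 0)) :=
    (Continuous.inv₀ (by fun_prop) fun ρ => by positivity).aestronglyMeasurable
  have hint : IntegrableOn (fun ρ : ℝ => ((r₀ ^ 2 + ρ ^ 2) ^ 2)⁻¹) (Ioi 0) := by
    refine hdom.mono' hmeas (Eventually.of_forall fun ρ => ?_)
    rw [Real.norm_eq_abs, abs_of_nonneg (by positivity)]
    exact hptw ρ
  refine ⟨hint, ?_⟩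
  calc ∫ ρ in Ioi (0 : ℝ), ((r₀ ^ 2 + ρ ^ 2) ^ 2)⁻¹ ≤ ∫ ρ in Ioi (0 : ℝ), (r₀ ^ 2)⁻¹ * (r₀ ^ 2 + ρ ^ 2)⁻¹ :=
        setIntegral_mono_on hint hdom measurableSet_Ioi fun ρ _ => hptw ρ
    _ = π / (2 * r₀ ^ 3) := by
        rw [integral_const_mul, hval]
        field_simp

/-- `∫₀^∞ r₀² dρ / (r₀² + ρ²) = π r₀ / 2` for `r₀ > 0`, with integrability. [folklore] -/
theorem integrableOn_and_integral_Ioi_radialProfile {r₀ : ℝ} (hr₀ : 0 < r₀) :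
    IntegrableOn (fun ρ : ℝ => r₀ ^ 2 / (r₀ ^ 2 + ρ ^ 2)) (Ioi 0) ∧
    ∫ ρ in Ioi (0 : ℝ), r₀ ^ 2 / (r₀ ^ 2 + ρ ^ 2) = π * r₀ / 2 := by
  obtain ⟨hi, hval⟩ := integrableOn_and_integral_Ioi_inv_sq_add_sq hr₀
  have heq : (fun ρ : ℝ => r₀ ^ 2 / (r₀ ^ 2 + ρ ^ 2)) = fun ρ => r₀ ^ 2 * (r₀ ^ 2 + ρ ^ 2)⁻¹ := by
    funext ρ; rw [div_eq_mul_inv]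
  rw [heq]
  refine ⟨hi.const_mul _, ?_⟩
  rw [integral_const_mul, hval]
  field_simp

end Elementary

/-! ### The envelope of `|Γ² − L²|` and its radial integrals -/

section Envelope

variable {K₁ E r₁ : ℝ}

/-- The envelope `e(ρ) = K₁ (ρ ≤ r₁), = E/ρ (ρ > r₁)` is measurable. [folklore] -/
theorem measurable_envelope (K₁ E r₁ : ℝ) :
    Measurable fun ρ : ℝ => if ρ ≤ r₁ then K₁ else E / ρ :=
  Measurable.ite measurableSet_Iic measurable_const (measurable_const.div measurable_id)

/-- The envelope is nonnegative on `(0, ∞)` when `K₁, E ≥ 0`. [folklore] -/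
theorem envelope_nonneg (hK₁ : 0 ≤ K₁) (hE : 0 ≤ E) {ρ : ℝ} (hρ : 0 < ρ) :
    0 ≤ (if ρ ≤ r₁ then K₁ else E / ρ) := by
  split_ifs
  · exact hK₁
  · positivity

/-- **Radial integrals of the envelope, first form** (Lei–Ren–Zhang 2019, §4, Step 5, p. 11:
"`|I₁| ≤ C R T sup |v_r| r₀ ∫_{r₀}^{R₀} ε/r² dr ≤ C ε R T sup |v_r|`"): for `φ ≥ 0` continuous
and integrable on `(0, ∞)` with `ρ φ(ρ) ≤ A` on `(0, r₁]`,
`∫₀^∞ ρ e(ρ) φ(ρ) dρ ≤ K₁ A r₁ + E ∫₀^∞ φ`, with integrability. [cite: LeiRenZhang2019, §4 Step 5 (arXiv p. 11)] -/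
theorem integrableOn_and_setIntegral_mul_envelope_mul_le (hK₁ : 0 ≤ K₁) (hE : 0 ≤ E) (hr₁ : 0 < r₁)
    {φ : ℝ → ℝ} {A : ℝ} (hφc : ContinuousOn φ (Ioi 0)) (hφ0 : ∀ ρ ∈ Ioi (0 : ℝ), 0 ≤ φ ρ)
    (hφi : IntegrableOn φ (Ioi 0)) (hA : ∀ ρ ∈ Ioc (0 : ℝ) r₁, ρ * φ ρ ≤ A) :
    IntegrableOn (fun ρ : ℝ => ρ * ((if ρ ≤ r₁ then K₁ else E / ρ) * φ ρ)) (Ioi 0) ∧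
    ∫ ρ in Ioi (0 : ℝ), ρ * ((if ρ ≤ r₁ then K₁ else E / ρ) * φ ρ) ≤ K₁ * A * r₁ + E * ∫ ρ in Ioi (0 : ℝ), φ ρ := by
  have hA0 : 0 ≤ A := by
    have h := hA r₁ ⟨hr₁, le_rfl⟩
    exact le_trans (mul_nonneg hr₁.le (hφ0 r₁ hr₁)) h
  -- the dominating function
  set Dm : ℝ → ℝ := fun ρ => (Ioc 0 r₁).indicator (fun _ => K₁ * A) ρ + E * φ ρ with hDm
  have hind : IntegrableOn (fun ρ : ℝ => (Ioc 0 r₁).indicator (fun _ => K₁ * A) ρ) (Ioi 0) :=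
    ((integrableOn_const (C := K₁ * A) (by exact measure_Ioc_lt_top.ne)).integrable_indicator
      measurableSet_Ioc).integrableOn
  have hDmi : IntegrableOn Dm (Ioi 0) := hind.add (hφi.const_mul E)
  -- pointwise comparison on `(0, ∞)`
  have hptw : ∀ ρ ∈ Ioi (0 : ℝ), 0 ≤ ρ * ((if ρ ≤ r₁ then K₁ else E / ρ) * φ ρ) ∧
      ρ * ((if ρ ≤ r₁ then K₁ else E / ρ) * φ ρ) ≤ Dm ρ := by
    intro ρ hρ
    have hρ0 : 0 < ρ := hρ
    have hφρ := hφ0 ρ hρ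
    refine ⟨mul_nonneg hρ0.le (mul_nonneg (envelope_nonneg hK₁ hE hρ0) hφρ), ?_⟩
    simp only [hDm]
    by_cases h : ρ ≤ r₁
    · have hm : ρ ∈ Ioc (0 : ℝ) r₁ := ⟨hρ0, h⟩
      rw [if_pos h, Set.indicator_of_mem hm]
      have h1 : ρ * (K₁ * φ ρ) = K₁ * (ρ * φ ρ) := by ring
      rw [h1]
      nlinarith [hA ρ hm, mul_nonneg hE hφρ]
    · have hm : ρ ∉ Ioc (0 : ℝ) r₁ := fun hm => h hm.2
      rw [if_neg h, Set.indicator_of_notMem hm]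
      have h1 : ρ * (E / ρ * φ ρ) = E * φ ρ := by field_simp
      rw [h1]; linarith
  have hmeas : AEStronglyMeasurable (fun ρ : ℝ => ρ * ((if ρ ≤ r₁ then K₁ else E / ρ) * φ ρ))
      (volume.restrict (Ioi 0)) :=
    (continuous_id.aestronglyMeasurable).mul (((measurable_envelope K₁ E r₁).aestronglyMeasurable).mul
      (hφc.aestronglyMeasurable measurableSet_Ioi))
  have hint : IntegrableOn (fun ρ : ℝ => ρ * ((if ρ ≤ r₁ then K₁ else E / ρ) * φ ρ)) (Ioi 0) := by
    refine hDmi.mono' hmeas ?_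
    rw [ae_restrict_iff' measurableSet_Ioi]
    refine Eventually.of_forall fun ρ hρ => ?_
    rw [Real.norm_eq_abs, abs_of_nonneg (hptw ρ hρ).1]
    exact (hptw ρ hρ).2
  refine ⟨hint, ?_⟩
  calc ∫ ρ in Ioi (0 : ℝ), ρ * ((if ρ ≤ r₁ then K₁ else E / ρ) * φ ρ) ≤ ∫ ρ in Ioi (0 : ℝ), Dm ρ :=
        setIntegral_mono_on hint hDmi measurableSet_Ioi fun ρ hρ => (hptw ρ hρ).2
    _ = K₁ * A * r₁ + E * ∫ ρ in Ioi (0 : ℝ), φ ρ := by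
        simp only [hDm]
        rw [integral_add hind (hφi.const_mul E), integral_const_mul, setIntegral_indicator measurableSet_Ioc,
          show Ioi (0 : ℝ) ∩ Ioc 0 r₁ = Ioc 0 r₁ from inter_eq_right.2 Ioc_subset_Ioi_self,
          setIntegral_const, Real.volume_real_Ioc_of_le hr₁.le, smul_eq_mul]
        ring

/-- **Radial integrals of the envelope, second form**: for `ψ ≥ 0` continuous and integrable on
`(0, ∞)` with `ψ ≤ A'` on `(0, r₁]`, `∫₀^∞ e ψ ≤ K₁ A' r₁ + (E/r₁) ∫₀^∞ ψ`, with integrability.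
[cite: LeiRenZhang2019, §4 Step 5 (arXiv p. 11)] -/
theorem integrableOn_and_setIntegral_envelope_mul_le (hK₁ : 0 ≤ K₁) (hE : 0 ≤ E) (hr₁ : 0 < r₁)
    {ψ : ℝ → ℝ} {A' : ℝ} (hψc : ContinuousOn ψ (Ioi 0)) (hψ0 : ∀ ρ ∈ Ioi (0 : ℝ), 0 ≤ ψ ρ)
    (hψi : IntegrableOn ψ (Ioi 0)) (hA' : ∀ ρ ∈ Ioc (0 : ℝ) r₁, ψ ρ ≤ A') :
    IntegrableOn (fun ρ : ℝ => (if ρ ≤ r₁ then K₁ else E / ρ) * ψ ρ) (Ioi 0) ∧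
    ∫ ρ in Ioi (0 : ℝ), (if ρ ≤ r₁ then K₁ else E / ρ) * ψ ρ ≤ K₁ * A' * r₁ + E / r₁ * ∫ ρ in Ioi (0 : ℝ), ψ ρ := by
  have hA0 : 0 ≤ A' := (hψ0 r₁ hr₁).trans (hA' r₁ ⟨hr₁, le_rfl⟩)
  set Dm : ℝ → ℝ := fun ρ => (Ioc 0 r₁).indicator (fun _ => K₁ * A') ρ + E / r₁ * ψ ρ with hDm
  have hind : IntegrableOn (fun ρ : ℝ => (Ioc 0 r₁).indicator (fun _ => K₁ * A') ρ) (Ioi 0) :=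
    ((integrableOn_const (C := K₁ * A') (by exact measure_Ioc_lt_top.ne)).integrable_indicator
      measurableSet_Ioc).integrableOn
  have hDmi : IntegrableOn Dm (Ioi 0) := hind.add (hψi.const_mul (E / r₁))
  have hptw : ∀ ρ ∈ Ioi (0 : ℝ), 0 ≤ (if ρ ≤ r₁ then K₁ else E / ρ) * ψ ρ ∧
      (if ρ ≤ r₁ then K₁ else E / ρ) * ψ ρ ≤ Dm ρ := by
    intro ρ hρ
    have hρ0 : 0 < ρ := hρ
    have hψρ := hψ0 ρ hρ
    refine ⟨mul_nonneg (envelope_nonneg hK₁ hE hρ0) hψρ, ?_⟩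
    simp only [hDm]
    by_cases h : ρ ≤ r₁
    · have hm : ρ ∈ Ioc (0 : ℝ) r₁ := ⟨hρ0, h⟩
      rw [if_pos h, Set.indicator_of_mem hm]
      nlinarith [hA' ρ hm, mul_nonneg (div_nonneg hE hr₁.le) hψρ]
    · have hm : ρ ∉ Ioc (0 : ℝ) r₁ := fun hm => h hm.2
      rw [if_neg h, Set.indicator_of_notMem hm, zero_add]
      have hr : E / ρ ≤ E / r₁ := div_le_div_of_nonneg_left hE hr₁ (le_of_lt (not_le.1 h))
      exact mul_le_mul_of_nonneg_right hr hψρ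
  have hmeas : AEStronglyMeasurable (fun ρ : ℝ => (if ρ ≤ r₁ then K₁ else E / ρ) * ψ ρ)
      (volume.restrict (Ioi 0)) :=
    ((measurable_envelope K₁ E r₁).aestronglyMeasurable).mul (hψc.aestronglyMeasurable measurableSet_Ioi)
  have hint : IntegrableOn (fun ρ : ℝ => (if ρ ≤ r₁ then K₁ else E / ρ) * ψ ρ) (Ioi 0) := by
    refine hDmi.mono' hmeas ?_
    rw [ae_restrict_iff' measurableSet_Ioi]
    refine Eventually.of_forall fun ρ hρ => ?_
    rw [Real.norm_eq_abs, abs_of_nonneg (hptw ρ hρ).1]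
    exact (hptw ρ hρ).2
  refine ⟨hint, ?_⟩
  calc ∫ ρ in Ioi (0 : ℝ), (if ρ ≤ r₁ then K₁ else E / ρ) * ψ ρ ≤ ∫ ρ in Ioi (0 : ℝ), Dm ρ :=
        setIntegral_mono_on hint hDmi measurableSet_Ioi fun ρ hρ => (hptw ρ hρ).2
    _ = K₁ * A' * r₁ + E / r₁ * ∫ ρ in Ioi (0 : ℝ), ψ ρ := by
        simp only [hDm]
        rw [integral_add hind (hψi.const_mul (E / r₁)), integral_const_mul, setIntegral_indicator measurableSet_Ioc,
          show Ioi (0 : ℝ) ∩ Ioc 0 r₁ = Ioc 0 r₁ from inter_eq_right.2 Ioc_subset_Ioi_self,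
          setIntegral_const, Real.volume_real_Ioc_of_le hr₁.le, smul_eq_mul]
        ring

end Envelope

/-! ### The radial integral of the junk terms -/

section Junk

variable {r₀ r₁ K₁ E R B₁ B₂ Cb M : ℝ}

/-- **The radial integral of the envelope against the pointwise bound of the junk terms**
(the right-hand side of `abs_junk_productWeight_le` of `LeiRenZhangSwirlWeights`): with
`h(ρ) = 8r₀²/D² + (B₂/R² + B₁C_b/R) r₀²/D + (4r₀²B₁/R + 2r₀²M) ρ/D² + (2B₁/R)(r₀²/D)/ρ`,
`D = r₀² + ρ²`, the function `ρ e(ρ) h(ρ)` is integrable on `(0, ∞)` and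
`∫₀^∞ ρ e h ≤ K₁ r₁ (8r₁/r₀² + (B₂/R² + B₁C_b/R) r₁ + (4r₀²B₁/R + 2r₀²M) r₁²/r₀⁴)
  + E (4π/r₀ + (B₂/R² + B₁C_b/R) πr₀/2 + (4r₀²B₁/R + 2r₀²M)/(2r₀²)) + (2B₁/R)(K₁ r₁ + (E/r₁) πr₀/2)`
(Lei–Ren–Zhang 2019, §4, Steps 4–5: the bounds for `T₂, T₃, T₁₁–T₁₆, I₁`; here the main term is
`E · (2r₀²M)/(2r₀²) = ε₀ L² M`, the printed "`C ε R T sup |v_r|`"). [cite: LeiRenZhang2019, §4 Steps 4–5, (4.7)–(4.13) (arXiv pp. 11–12)] -/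
theorem radial_junk_integral_le (hr₀ : 0 < r₀) (hr₁ : 0 < r₁) (hK₁ : 0 ≤ K₁) (hE : 0 ≤ E) (hR : 0 < R)
    (hB₁ : 0 ≤ B₁) (hB₂ : 0 ≤ B₂) (hCb : 0 ≤ Cb) (hM : 0 ≤ M) :
    IntegrableOn (fun ρ : ℝ => ρ * ((if ρ ≤ r₁ then K₁ else E / ρ) *
      (8 * r₀ ^ 2 / (r₀ ^ 2 + ρ ^ 2) ^ 2
        + (B₂ / R ^ 2 + B₁ * Cb / R) * (r₀ ^ 2 / (r₀ ^ 2 + ρ ^ 2))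
        + (4 * r₀ ^ 2 * B₁ / R + 2 * r₀ ^ 2 * M) * ρ / (r₀ ^ 2 + ρ ^ 2) ^ 2
        + 2 * B₁ / R * (r₀ ^ 2 / (r₀ ^ 2 + ρ ^ 2)) / ρ))) (Ioi 0) ∧
    ∫ ρ in Ioi (0 : ℝ), ρ * ((if ρ ≤ r₁ then K₁ else E / ρ) *
      (8 * r₀ ^ 2 / (r₀ ^ 2 + ρ ^ 2) ^ 2
        + (B₂ / R ^ 2 + B₁ * Cb / R) * (r₀ ^ 2 / (r₀ ^ 2 + ρ ^ 2))
        + (4 * r₀ ^ 2 * B₁ / R + 2 * r₀ ^ 2 * M) * ρ / (r₀ ^ 2 + ρ ^ 2) ^ 2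
        + 2 * B₁ / R * (r₀ ^ 2 / (r₀ ^ 2 + ρ ^ 2)) / ρ)) ≤
      K₁ * r₁ * (8 * r₁ / r₀ ^ 2 + (B₂ / R ^ 2 + B₁ * Cb / R) * r₁
          + (4 * r₀ ^ 2 * B₁ / R + 2 * r₀ ^ 2 * M) * r₁ ^ 2 / r₀ ^ 4)
      + E * (4 * π / r₀ + (B₂ / R ^ 2 + B₁ * Cb / R) * (π * r₀ / 2)
          + (4 * r₀ ^ 2 * B₁ / R + 2 * r₀ ^ 2 * M) / (2 * r₀ ^ 2))
      + 2 * B₁ / R * (K₁ * r₁ + E / r₁ * (π * r₀ / 2)) := by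
  set c₂ : ℝ := B₂ / R ^ 2 + B₁ * Cb / R with hc₂
  set c₃ : ℝ := 4 * r₀ ^ 2 * B₁ / R + 2 * r₀ ^ 2 * M with hc₃
  set c₄ : ℝ := 2 * B₁ / R with hc₄
  have hc₂0 : 0 ≤ c₂ := by positivity
  have hc₃0 : 0 ≤ c₃ := by positivity
  have hc₄0 : 0 ≤ c₄ := by positivity
  -- the pieces
  set φ₁ : ℝ → ℝ := fun ρ => 8 * r₀ ^ 2 / (r₀ ^ 2 + ρ ^ 2) ^ 2 + c₂ * (r₀ ^ 2 / (r₀ ^ 2 + ρ ^ 2))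
    + c₃ * ρ / (r₀ ^ 2 + ρ ^ 2) ^ 2 with hφ₁
  set W : ℝ → ℝ := fun ρ => r₀ ^ 2 / (r₀ ^ 2 + ρ ^ 2) with hW
  obtain ⟨hI2, hI2v⟩ := integrableOn_and_integral_Ioi_inv_sq_add_sq_sq_le hr₀
  obtain ⟨hIW, hIWv⟩ := integrableOn_and_integral_Ioi_radialProfile hr₀
  obtain ⟨hI3, hI3v⟩ := integrableOn_and_integral_Ioi_mul_inv_sq_add_sq_sq hr₀ le_rfl
  have hφ₁c : ContinuousOn φ₁ (Ioi 0) := by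
    refine Continuous.continuousOn ?_
    simp only [hφ₁]
    have hD : ∀ ρ : ℝ, r₀ ^ 2 + ρ ^ 2 ≠ 0 := fun ρ => by positivity
    have hD2 : ∀ ρ : ℝ, (r₀ ^ 2 + ρ ^ 2) ^ 2 ≠ 0 := fun ρ => by positivity
    fun_prop (disch := assumption)
  have hWc : ContinuousOn W (Ioi 0) := by
    refine Continuous.continuousOn ?_
    simp only [hW]
    have hD : ∀ ρ : ℝ, r₀ ^ 2 + ρ ^ 2 ≠ 0 := fun ρ => by positivity
    fun_prop (disch := assumption)
  have hφ₁0 : ∀ ρ ∈ Ioi (0 : ℝ), 0 ≤ φ₁ ρ := fun ρ hρ => by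
    have : 0 < ρ := hρ
    simp only [hφ₁]; positivity
  have hW0 : ∀ ρ ∈ Ioi (0 : ℝ), 0 ≤ W ρ := fun ρ _ => by simp only [hW]; positivity
  have h1i : IntegrableOn (fun ρ : ℝ => 8 * r₀ ^ 2 / (r₀ ^ 2 + ρ ^ 2) ^ 2) (Ioi 0) := by
    have h : IntegrableOn (fun ρ : ℝ => 8 * r₀ ^ 2 * ((r₀ ^ 2 + ρ ^ 2) ^ 2)⁻¹) (Ioi 0) := hI2.const_mul (8 * r₀ ^ 2)
    exact h.congr_fun (fun ρ _ => by simp only [div_eq_mul_inv]) measurableSet_Ioi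
  have h2i : IntegrableOn (fun ρ : ℝ => c₂ * (r₀ ^ 2 / (r₀ ^ 2 + ρ ^ 2))) (Ioi 0) := hIW.const_mul c₂
  have h3i : IntegrableOn (fun ρ : ℝ => c₃ * ρ / (r₀ ^ 2 + ρ ^ 2) ^ 2) (Ioi 0) := by
    have h : IntegrableOn (fun ρ : ℝ => c₃ * (ρ / (r₀ ^ 2 + ρ ^ 2) ^ 2)) (Ioi 0) := hI3.const_mul c₃
    exact h.congr_fun (fun ρ _ => by ring) measurableSet_Ioi
  have h12i : IntegrableOn (fun ρ : ℝ => 8 * r₀ ^ 2 / (r₀ ^ 2 + ρ ^ 2) ^ 2 + c₂ * (r₀ ^ 2 / (r₀ ^ 2 + ρ ^ 2))) (Ioi 0) :=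
    h1i.add h2i
  have hφ₁i : IntegrableOn φ₁ (Ioi 0) := h12i.add h3i
  have hφ₁v : ∫ ρ in Ioi (0 : ℝ), φ₁ ρ ≤ 4 * π / r₀ + c₂ * (π * r₀ / 2) + c₃ / (2 * r₀ ^ 2) := by
    have e1 : ∫ ρ in Ioi (0 : ℝ), 8 * r₀ ^ 2 / (r₀ ^ 2 + ρ ^ 2) ^ 2 = 8 * r₀ ^ 2 * ∫ ρ in Ioi (0 : ℝ), ((r₀ ^ 2 + ρ ^ 2) ^ 2)⁻¹ := by
      rw [← integral_const_mul]
      exact integral_congr_ae (Eventually.of_forall fun ρ => by simp only [div_eq_mul_inv])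
    have e2 : ∫ ρ in Ioi (0 : ℝ), c₂ * (r₀ ^ 2 / (r₀ ^ 2 + ρ ^ 2)) = c₂ * (π * r₀ / 2) := by
      rw [integral_const_mul, hIWv]
    have e3 : ∫ ρ in Ioi (0 : ℝ), c₃ * ρ / (r₀ ^ 2 + ρ ^ 2) ^ 2 = c₃ * (1 / (2 * (r₀ ^ 2 + (0 : ℝ) ^ 2))) := by
      rw [← hI3v, ← integral_const_mul]
      exact integral_congr_ae (Eventually.of_forall fun ρ => by ring)
    have esum : ∫ ρ in Ioi (0 : ℝ), φ₁ ρ = (∫ ρ in Ioi (0 : ℝ), 8 * r₀ ^ 2 / (r₀ ^ 2 + ρ ^ 2) ^ 2)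
        + (∫ ρ in Ioi (0 : ℝ), c₂ * (r₀ ^ 2 / (r₀ ^ 2 + ρ ^ 2))) + ∫ ρ in Ioi (0 : ℝ), c₃ * ρ / (r₀ ^ 2 + ρ ^ 2) ^ 2 := by
      simp only [hφ₁]
      rw [integral_add h12i h3i, integral_add h1i h2i]
    have hb1 : 8 * r₀ ^ 2 * ∫ ρ in Ioi (0 : ℝ), ((r₀ ^ 2 + ρ ^ 2) ^ 2)⁻¹ ≤ 4 * π / r₀ := by
      calc 8 * r₀ ^ 2 * ∫ ρ in Ioi (0 : ℝ), ((r₀ ^ 2 + ρ ^ 2) ^ 2)⁻¹ ≤ 8 * r₀ ^ 2 * (π / (2 * r₀ ^ 3)) :=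
            mul_le_mul_of_nonneg_left hI2v (by positivity)
        _ = 4 * π / r₀ := by field_simp; ring
    have hb3 : c₃ * (1 / (2 * (r₀ ^ 2 + (0 : ℝ) ^ 2))) = c₃ / (2 * r₀ ^ 2) := by ring
    rw [esum, e1, e2, e3, hb3]
    linarith
  -- (1) the `φ₁` part
  have hA : ∀ ρ ∈ Ioc (0 : ℝ) r₁, ρ * φ₁ ρ ≤ 8 * r₁ / r₀ ^ 2 + c₂ * r₁ + c₃ * r₁ ^ 2 / r₀ ^ 4 := by
    intro ρ hρ
    have hρ0 : 0 < ρ := hρ.1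
    have hρ1 : ρ ≤ r₁ := hρ.2
    have hD : r₀ ^ 2 ≤ r₀ ^ 2 + ρ ^ 2 := by nlinarith
    have hDpos : 0 < r₀ ^ 2 + ρ ^ 2 := by positivity
    -- the three terms
    have t1 : ρ * (8 * r₀ ^ 2 / (r₀ ^ 2 + ρ ^ 2) ^ 2) ≤ 8 * r₁ / r₀ ^ 2 := by
      have h1 : 8 * r₀ ^ 2 / (r₀ ^ 2 + ρ ^ 2) ^ 2 ≤ 8 * r₀ ^ 2 / (r₀ ^ 2) ^ 2 :=
        div_le_div_of_nonneg_left (by positivity) (by positivity) (pow_le_pow_left₀ (by positivity) hD 2)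
      calc ρ * (8 * r₀ ^ 2 / (r₀ ^ 2 + ρ ^ 2) ^ 2) ≤ r₁ * (8 * r₀ ^ 2 / (r₀ ^ 2) ^ 2) :=
            mul_le_mul hρ1 h1 (by positivity) hr₁.le
        _ = 8 * r₁ / r₀ ^ 2 := by field_simp
    have t2 : ρ * (c₂ * (r₀ ^ 2 / (r₀ ^ 2 + ρ ^ 2))) ≤ c₂ * r₁ := by
      have hW1 : r₀ ^ 2 / (r₀ ^ 2 + ρ ^ 2) ≤ 1 := by rw [div_le_one hDpos]; exact hD
      calc ρ * (c₂ * (r₀ ^ 2 / (r₀ ^ 2 + ρ ^ 2))) ≤ r₁ * (c₂ * 1) :=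
            mul_le_mul hρ1 (mul_le_mul_of_nonneg_left hW1 hc₂0) (by positivity) hr₁.le
        _ = c₂ * r₁ := by ring
    have t3 : ρ * (c₃ * ρ / (r₀ ^ 2 + ρ ^ 2) ^ 2) ≤ c₃ * r₁ ^ 2 / r₀ ^ 4 := by
      have h1 : ρ * (c₃ * ρ / (r₀ ^ 2 + ρ ^ 2) ^ 2) = c₃ * (ρ ^ 2 / (r₀ ^ 2 + ρ ^ 2) ^ 2) := by ring
      rw [h1]
      have h2 : ρ ^ 2 / (r₀ ^ 2 + ρ ^ 2) ^ 2 ≤ r₁ ^ 2 / (r₀ ^ 2) ^ 2 := by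
        gcongr
      calc c₃ * (ρ ^ 2 / (r₀ ^ 2 + ρ ^ 2) ^ 2) ≤ c₃ * (r₁ ^ 2 / (r₀ ^ 2) ^ 2) := mul_le_mul_of_nonneg_left h2 hc₃0
        _ = c₃ * r₁ ^ 2 / r₀ ^ 4 := by ring
    simp only [hφ₁]
    nlinarith [t1, t2, t3]
  obtain ⟨hint1, hval1⟩ := integrableOn_and_setIntegral_mul_envelope_mul_le (E := E) hK₁ hE hr₁ hφ₁c hφ₁0 hφ₁i hA
  -- (2) the `W` part
  have hA' : ∀ ρ ∈ Ioc (0 : ℝ) r₁, W ρ ≤ 1 := fun ρ _ => by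
    simp only [hW]
    rw [div_le_one (by positivity)]
    nlinarith
  obtain ⟨hint2, hval2⟩ := integrableOn_and_setIntegral_envelope_mul_le (E := E) hK₁ hE hr₁ hWc hW0 hIW hA'
  -- the integrand on `(0, ∞)`
  have heq : ∀ ρ ∈ Ioi (0 : ℝ), ρ * ((if ρ ≤ r₁ then K₁ else E / ρ) *
      (8 * r₀ ^ 2 / (r₀ ^ 2 + ρ ^ 2) ^ 2
        + (B₂ / R ^ 2 + B₁ * Cb / R) * (r₀ ^ 2 / (r₀ ^ 2 + ρ ^ 2))
        + (4 * r₀ ^ 2 * B₁ / R + 2 * r₀ ^ 2 * M) * ρ / (r₀ ^ 2 + ρ ^ 2) ^ 2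
        + 2 * B₁ / R * (r₀ ^ 2 / (r₀ ^ 2 + ρ ^ 2)) / ρ)) =
      ρ * ((if ρ ≤ r₁ then K₁ else E / ρ) * φ₁ ρ) + c₄ * ((if ρ ≤ r₁ then K₁ else E / ρ) * W ρ) := by
    intro ρ hρ
    have hρ0 : (ρ : ℝ) ≠ 0 := ne_of_gt hρ
    simp only [hφ₁, hW, hc₂, hc₃, hc₄]
    field_simp
  have hsum : IntegrableOn (fun ρ : ℝ => ρ * ((if ρ ≤ r₁ then K₁ else E / ρ) * φ₁ ρ) +
      c₄ * ((if ρ ≤ r₁ then K₁ else E / ρ) * W ρ)) (Ioi 0) := hint1.add (hint2.const_mul c₄)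
  refine ⟨hsum.congr_fun (fun ρ hρ => (heq ρ hρ).symm) measurableSet_Ioi, ?_⟩
  rw [setIntegral_congr_fun measurableSet_Ioi heq, integral_add hint1 (hint2.const_mul c₄), integral_const_mul]
  have h2' : c₄ * ∫ ρ in Ioi (0 : ℝ), (if ρ ≤ r₁ then K₁ else E / ρ) * W ρ ≤ c₄ * (K₁ * 1 * r₁ + E / r₁ * (π * r₀ / 2)) := by
    refine mul_le_mul_of_nonneg_left ?_ hc₄0
    simpa only [hW, hIWv] using hval2
  have h1' : ∫ ρ in Ioi (0 : ℝ), ρ * ((if ρ ≤ r₁ then K₁ else E / ρ) * φ₁ ρ) ≤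
      K₁ * (8 * r₁ / r₀ ^ 2 + c₂ * r₁ + c₃ * r₁ ^ 2 / r₀ ^ 4) * r₁ + E * (4 * π / r₀ + c₂ * (π * r₀ / 2) + c₃ / (2 * r₀ ^ 2)) :=
    hval1.trans (add_le_add le_rfl (mul_le_mul_of_nonneg_left hφ₁v hE))
  have hRHS : K₁ * r₁ * (8 * r₁ / r₀ ^ 2 + c₂ * r₁ + c₃ * r₁ ^ 2 / r₀ ^ 4)
      + E * (4 * π / r₀ + c₂ * (π * r₀ / 2) + c₃ / (2 * r₀ ^ 2))
      + c₄ * (K₁ * r₁ + E / r₁ * (π * r₀ / 2)) =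
      (K₁ * (8 * r₁ / r₀ ^ 2 + c₂ * r₁ + c₃ * r₁ ^ 2 / r₀ ^ 4) * r₁ + E * (4 * π / r₀ + c₂ * (π * r₀ / 2) + c₃ / (2 * r₀ ^ 2)))
      + c₄ * (K₁ * 1 * r₁ + E / r₁ * (π * r₀ / 2)) := by ring
  rw [hRHS]
  exact add_le_add h1' h2'

end Junk

end Literature.Analysis.FluidPDE

end
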